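import Mathlib.Analysis.SpecialFunctions.ImproperIntegrals
import Literature.Analysis.FluidPDE.SawtoothCascadeProfileCurvature
import HarnessLib
import Summits.AnomalousDissipation.AnomalousDissipation.Theses.SawtoothPulseCascade

/-!
# K1loc — helper: THE FLAT-SLOPE LEMMA (the rounded sawtooth has slope `±1` up to a Gaussian tail off the corners)

Helper file of the first prover lane on the crux `K1LocalisedCascade` (stmt-AnomalousDissipation-19491), route
`SawtoothPulseCascade` (card `sequential-cone-partial-mixing` items L3/L6 "zone measure"; memo F-f / F-d′).  The cascade profile
is `U j y = S_δ(2πN y)/(2πN)` with the rounded sawtooth `S_δ = tri ⋆ g_δ` (`SawtoothCascade.roundedSaw`, Gaussian `gaussKernel δ`);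
the robust cone / leakage bookkeeping of the line needs the slope floor `|S_δ′| ≥ ρ_j` OFF the corner zones together with an
explicit zone width.  Since `S_δ′ = tri′ ⋆ g_δ` (tree `hasDerivAt_roundedSaw`) and `tri′ = ±1` is constant on each branch, at
`θ`-distance `≥ D` from the corners the slope differs from `±1` only by the Gaussian mass beyond `D`:

* `gaussKernel_le_exp_tail_right` / `_left` — `g_δ(y) ≤ (e^{−D²/2δ²}/(δ√(2π))) · e^{∓D(y∓D)/δ²}` (tangent bounds of the
  concave exponent, from `(y ∓ D)² ≥ 0`), and `integral_indicator_Ici_exp` / `_Iic_exp` — each exponential tail has mass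
  `δ²/D`, so the two-sided majorant integrates to `2δ e^{−D²/2δ²}/(D√(2π))`;
* `abs_deriv_roundedSaw_sub_le` — **flat-slope lemma**: if `tri′(θ − y) = s` for all `|y| < D` (θ is `D`-inside one branch,
  `s = ±1` supplied by `hasDerivAt_tri_of_mem_Ioo` / `…_Ioo'`) and `|s| ≤ 1`, then
  `|S_δ′(θ) − s| ≤ 4δ e^{−D²/(2δ²)} / (D √(2π))`   (`0 < δ`, `0 < D`);
* `abs_deriv_roundedSaw_sub_one_le` / `abs_deriv_roundedSaw_add_one_le` — the two branches spelled out: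
  `θ ∈ [−π/2 + D, π/2 − D] (mod 2π)` gives `|S_δ′(θ) − 1| ≤ …`, `θ ∈ [π/2 + D, 3π/2 − D]` gives `|S_δ′(θ) + 1| ≤ …`;
* `abs_deriv_roundedSaw_sub_le_of_sd` — in standard deviations: `D = Mδ`, `M ≥ 1` gives `|S_δ′(θ) − s| ≤ 2e^{−M²/2}`;
  `abs_deriv_U_sub_one_le` / `abs_deriv_U_add_one_le` — the same for the cascade profile `U j` (tree `deriv_U_eq`:
  `U_j′(y) = S_{δ_j}′(2πN_j y)`); `two_mul_exp_neg_le_half_pow` — `M = √(2(j+1))` yields the slope floor `1 − 2^{−j}` of TEST H.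

Consequence for the cascade (used by the line, not restated here): with `δ_j = 2^{−j}/4` the slope floor `1 − 2^{−j}` of TEST H
holds outside corner zones of half-width `D_j = δ_j √(2 ln(C·2^j))`, i.e. zone measure `≍ √j · 2^{−j}` per unit length — summable.
WHAT THIS IS NOT: no statement about the scalar.  [cite: Folland1999, §8.2 Prop. 8.10 (∂(f ⋆ g) = (∂f) ⋆ g) and Prop. 2.53 (Gaussian integrals)]
[problem: turb]
-/

-- `Summit.<Summit>.<Problem>`: single-conjunct summit, the duplicate namespace segment is deliberate.
set_option linter.dupNamespace false

noncomputable section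

namespace Summit.AnomalousDissipation.AnomalousDissipation.Theorems.SawtoothPulseCascade.K1Flat

open MeasureTheory Set Filter Topology
open Literature.Analysis.FluidPDE.SawtoothCascade

/-! ## §1 The Gaussian tail beyond distance `D` -/

/-- **Gaussian tail, pointwise** (tangent bound of the concave exponent): for all `y`, `g_δ(y) ≤ E e^{−c(y−D)}` with
`E = e^{−D²/2δ²}/(δ√(2π))`, `c = D/δ²` (`(y − D)² ≥ 0`; used for `y ≥ D`). [cite: Folland1999, Prop. 2.53 (the Gaussian)] -/
theorem gaussKernel_le_exp_tail_right {δ : ℝ} (D y : ℝ) (hδ : 0 < δ) :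
    gaussKernel δ y ≤ Real.exp (-(D ^ 2 / (2 * δ ^ 2))) / (δ * Real.sqrt (2 * Real.pi)) *
      Real.exp (-(D / δ ^ 2) * (y - D)) := by
  unfold gaussKernel
  rw [div_mul_eq_mul_div, ← Real.exp_add]
  refine div_le_div_of_nonneg_right (Real.exp_le_exp.mpr ?_) (by positivity)
  have hδ2 : 0 < δ ^ 2 := by positivity
  rw [show -(D ^ 2 / (2 * δ ^ 2)) + -(D / δ ^ 2) * (y - D) = -((D ^ 2 + 2 * D * (y - D)) / (2 * δ ^ 2)) by
    field_simp; ring]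
  rw [neg_le_neg_iff, div_le_div_iff_of_pos_right (by positivity)]
  nlinarith [sq_nonneg (y - D)]

/-- Gaussian tail, pointwise, left side: for all `y`, `g_δ(y) ≤ E e^{c(y+D)}` (used for `y ≤ −D`).
[cite: Folland1999, Prop. 2.53 (the Gaussian)] -/
theorem gaussKernel_le_exp_tail_left {δ : ℝ} (D y : ℝ) (hδ : 0 < δ) :
    gaussKernel δ y ≤ Real.exp (-(D ^ 2 / (2 * δ ^ 2))) / (δ * Real.sqrt (2 * Real.pi)) *
      Real.exp ((D / δ ^ 2) * (y + D)) := by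
  unfold gaussKernel
  rw [div_mul_eq_mul_div, ← Real.exp_add]
  refine div_le_div_of_nonneg_right (Real.exp_le_exp.mpr ?_) (by positivity)
  have hδ2 : 0 < δ ^ 2 := by positivity
  rw [show -(D ^ 2 / (2 * δ ^ 2)) + (D / δ ^ 2) * (y + D) = -((D ^ 2 - 2 * D * (y + D)) / (2 * δ ^ 2)) by
    field_simp; ring]
  rw [neg_le_neg_iff, div_le_div_iff_of_pos_right (by positivity)]
  nlinarith [sq_nonneg (y + D)]

/-- The right exponential tail is integrable and `∫_{y ≥ D} e^{−c(y−D)} dy = 1/c` (`c > 0`).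
[cite: Folland1999, Prop. 2.53 (Gaussian integrals)] -/
theorem integral_indicator_Ici_exp {c D : ℝ} (hc : 0 < c) :
    Integrable (fun y => (Ici D).indicator (fun y => Real.exp (-c * (y - D))) y) ∧
      ∫ y, (Ici D).indicator (fun y => Real.exp (-c * (y - D))) y = 1 / c := by
  have hfun : (fun y : ℝ => Real.exp (-c * (y - D))) = fun y => Real.exp (c * D) * Real.exp (-c * y) := by
    funext y; rw [← Real.exp_add]; congr 1; ring
  have hint : IntegrableOn (fun y : ℝ => Real.exp (-c * (y - D))) (Ici D) := by
    rw [integrableOn_Ici_iff_integrableOn_Ioi, hfun]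
    exact (integrableOn_exp_mul_Ioi (neg_lt_zero.mpr hc) D).const_mul _
  refine ⟨hint.integrable_indicator measurableSet_Ici, ?_⟩
  rw [integral_indicator measurableSet_Ici, integral_Ici_eq_integral_Ioi, hfun, integral_const_mul,
    integral_exp_mul_Ioi (neg_lt_zero.mpr hc) D]
  rw [show Real.exp (c * D) * (-Real.exp (-c * D) / -c) = (Real.exp (c * D) * Real.exp (-c * D)) / c by
    field_simp, ← Real.exp_add, show c * D + -c * D = 0 by ring, Real.exp_zero]

/-- The left exponential tail is integrable and `∫_{y ≤ −D} e^{c(y+D)} dy = 1/c` (`c > 0`).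
[cite: Folland1999, Prop. 2.53 (Gaussian integrals)] -/
theorem integral_indicator_Iic_exp {c D : ℝ} (hc : 0 < c) :
    Integrable (fun y => (Iic (-D)).indicator (fun y => Real.exp (c * (y + D))) y) ∧
      ∫ y, (Iic (-D)).indicator (fun y => Real.exp (c * (y + D))) y = 1 / c := by
  have hfun : (fun y : ℝ => Real.exp (c * (y + D))) = fun y => Real.exp (c * D) * Real.exp (c * y) := by
    funext y; rw [← Real.exp_add]; congr 1; ring
  have hint : IntegrableOn (fun y : ℝ => Real.exp (c * (y + D))) (Iic (-D)) := by
    rw [hfun]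
    exact (integrableOn_exp_mul_Iic hc (-D)).const_mul _
  refine ⟨hint.integrable_indicator measurableSet_Iic, ?_⟩
  rw [integral_indicator measurableSet_Iic, hfun, integral_const_mul, integral_exp_mul_Iic hc (-D)]
  rw [show Real.exp (c * D) * (Real.exp (c * -D) / c) = (Real.exp (c * D) * Real.exp (c * -D)) / c by
    field_simp, ← Real.exp_add, show c * D + c * -D = 0 by ring, Real.exp_zero]

/-! ## §2 The flat-slope lemma -/

/-- **Flat-slope lemma** for the rounded sawtooth `S_δ = tri ⋆ g_δ`: if `θ` is `D`-inside one branch of the triangle wave,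
i.e. `tri′(θ − y) = s` for all `|y| < D`, with `|s| ≤ 1`, then
`|S_δ′(θ) − s| ≤ 4 δ e^{−D²/(2δ²)} / (D √(2π))`  (`0 < δ`, `0 < D`): off the corner zones the slope is `±1` up to a Gaussian tail.
[cite: Folland1999, §8.2 Prop. 8.10 (∂(f ⋆ g) = (∂f) ⋆ g) and Prop. 2.53 (Gaussian integrals)] -/
theorem abs_deriv_roundedSaw_sub_le {δ D θ s : ℝ} (hδ : 0 < δ) (hD : 0 < D) (hs1 : |s| ≤ 1)
    (hs : ∀ y : ℝ, |y| < D → deriv tri (θ - y) = s) :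
    |deriv (roundedSaw δ) θ - s| ≤ 4 * δ * Real.exp (-(D ^ 2 / (2 * δ ^ 2))) / (D * Real.sqrt (2 * Real.pi)) := by
  -- the derivative as a convolution and `s = ∫ s g_δ`
  rw [(hasDerivAt_roundedSaw hδ θ).deriv]
  have hIg := integrable_gaussKernel hδ
  have hI1 : Integrable (fun y => deriv tri (θ - y) * gaussKernel δ y) :=
    hIg.bdd_mul (c := 1) (((measurable_deriv tri).comp (measurable_const.sub measurable_id)).aestronglyMeasurable)
      (ae_of_all _ fun y => by rw [Real.norm_eq_abs]; exact abs_deriv_tri_le_one _)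
  have hI2 : Integrable (fun y => s * gaussKernel δ y) := hIg.const_mul s
  have hs_eq : s = ∫ y, s * gaussKernel δ y := by rw [integral_const_mul, integral_gaussKernel hδ, mul_one]
  rw [hs_eq, ← integral_sub hI1 hI2]
  -- constants of the majorant
  set E : ℝ := Real.exp (-(D ^ 2 / (2 * δ ^ 2))) / (δ * Real.sqrt (2 * Real.pi)) with hE
  set c : ℝ := D / δ ^ 2 with hc
  have hc0 : 0 < c := by positivity
  have hE0 : 0 ≤ E := by positivity
  set M : ℝ → ℝ := fun y => 2 * E * ((Ici D).indicator (fun y => Real.exp (-c * (y - D))) y +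
    (Iic (-D)).indicator (fun y => Real.exp (c * (y + D))) y) with hM
  obtain ⟨hR_int, hR_val⟩ := integral_indicator_Ici_exp (D := D) hc0
  obtain ⟨hL_int, hL_val⟩ := integral_indicator_Iic_exp (D := D) hc0
  have hM_int : Integrable M := (hR_int.add hL_int).const_mul (2 * E)
  have hM_val : ∫ y, M y = 4 * δ * Real.exp (-(D ^ 2 / (2 * δ ^ 2))) / (D * Real.sqrt (2 * Real.pi)) := by
    rw [hM, integral_const_mul, integral_add hR_int hL_int, hR_val, hL_val, hE, hc]
    field_simp
    ring
  -- pointwise domination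
  have hdom : ∀ y, ‖deriv tri (θ - y) * gaussKernel δ y - s * gaussKernel δ y‖ ≤ M y := by
    intro y
    rw [← sub_mul, norm_mul, Real.norm_eq_abs, Real.norm_eq_abs, abs_of_nonneg (gaussKernel_nonneg hδ.le y)]
    by_cases hy : |y| < D
    · rw [hs y hy, sub_self, abs_zero, zero_mul]
      have : 0 ≤ (Ici D).indicator (fun y => Real.exp (-c * (y - D))) y +
          (Iic (-D)).indicator (fun y => Real.exp (c * (y + D))) y :=
        add_nonneg (Set.indicator_nonneg (fun _ _ => (Real.exp_pos _).le) _)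
          (Set.indicator_nonneg (fun _ _ => (Real.exp_pos _).le) _)
      show 0 ≤ M y
      rw [hM]; positivity
    · have h2 : |deriv tri (θ - y) - s| ≤ 2 := by
        calc |deriv tri (θ - y) - s| ≤ |deriv tri (θ - y)| + |s| := abs_sub _ _
          _ ≤ 1 + 1 := add_le_add (abs_deriv_tri_le_one _) hs1
          _ = 2 := by norm_num
      have hyD : D ≤ |y| := le_of_not_gt hy
      rcases le_or_gt 0 y with hy0 | hy0
      · -- `y ≥ D`
        have hyD' : D ≤ y := by rwa [abs_of_nonneg hy0] at hyD
        have hg := gaussKernel_le_exp_tail_right D y hδ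
        have hind : (Ici D).indicator (fun y => Real.exp (-c * (y - D))) y = Real.exp (-c * (y - D)) :=
          Set.indicator_of_mem (show y ∈ Ici D from hyD') _
        have hind' : 0 ≤ (Iic (-D)).indicator (fun y => Real.exp (c * (y + D))) y :=
          Set.indicator_nonneg (fun _ _ => (Real.exp_pos _).le) _
        calc |deriv tri (θ - y) - s| * gaussKernel δ y ≤ 2 * (E * Real.exp (-c * (y - D))) :=
              mul_le_mul h2 (by rw [hE, hc]; simpa [neg_mul] using hg) (gaussKernel_nonneg hδ.le y) (by norm_num)
          _ ≤ M y := by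
              rw [hM]; simp only; rw [hind]; nlinarith [Real.exp_pos (-c * (y - D))]
      · -- `y ≤ -D`
        have hyD' : y ≤ -D := by rw [abs_of_neg hy0] at hyD; linarith
        have hg := gaussKernel_le_exp_tail_left D y hδ
        have hind : (Iic (-D)).indicator (fun y => Real.exp (c * (y + D))) y = Real.exp (c * (y + D)) :=
          Set.indicator_of_mem (show y ∈ Iic (-D) from hyD') _
        have hind' : 0 ≤ (Ici D).indicator (fun y => Real.exp (-c * (y - D))) y :=
          Set.indicator_nonneg (fun _ _ => (Real.exp_pos _).le) _
        calc |deriv tri (θ - y) - s| * gaussKernel δ y ≤ 2 * (E * Real.exp (c * (y + D))) :=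
              mul_le_mul h2 (by rw [hE, hc]; exact hg) (gaussKernel_nonneg hδ.le y) (by norm_num)
          _ ≤ M y := by
              rw [hM]; simp only; rw [hind]; nlinarith [Real.exp_pos (c * (y + D))]
  have h := norm_integral_le_of_norm_le hM_int (ae_of_all _ hdom)
  rw [Real.norm_eq_abs, hM_val] at h
  exact h

/-! ## §3 The two branches spelled out -/

/-- On the ascending branch: if `[θ − D, θ + D] ⊆ (−π/2, π/2) + 2πk` then `tri′(θ − y) = 1` for `|y| < D`. [folklore] -/
theorem deriv_tri_sub_eq_one {θ D y : ℝ} (k : ℤ) (h₁ : -(Real.pi / 2) + 2 * Real.pi * k < θ - D)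
    (h₂ : θ + D < Real.pi / 2 + 2 * Real.pi * k) (hy : |y| < D) : deriv tri (θ - y) = 1 := by
  have hy' := abs_lt.mp hy
  have hlo : -(Real.pi / 2) + 2 * Real.pi * k < θ - y := by linarith
  have hhi : θ - y < Real.pi / 2 + 2 * Real.pi * k := by linarith
  have hev : tri =ᶠ[𝓝 (θ - y)] fun t => t - 2 * Real.pi * k := by
    filter_upwards [Ioo_mem_nhds hlo hhi] with t ht
    have hper : tri t = tri (t - k * (2 * Real.pi)) := (tri_periodic.sub_int_mul_eq k).symm
    rw [hper, show t - k * (2 * Real.pi) = t - 2 * Real.pi * k by ring]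
    exact tri_eq_self (by linarith [ht.1]) (by linarith [ht.2])
  have hd : HasDerivAt tri 1 (θ - y) := by
    have h0 : HasDerivAt (fun t : ℝ => t - 2 * Real.pi * k) 1 (θ - y) := (hasDerivAt_id _).sub_const _
    exact h0.congr_of_eventuallyEq hev
  exact hd.deriv

/-- On the descending branch: if `[θ − D, θ + D] ⊆ (π/2, 3π/2) + 2πk` then `tri′(θ − y) = −1` for `|y| < D`. [folklore] -/
theorem deriv_tri_sub_eq_neg_one {θ D y : ℝ} (k : ℤ) (h₁ : Real.pi / 2 + 2 * Real.pi * k < θ - D)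
    (h₂ : θ + D < 3 * Real.pi / 2 + 2 * Real.pi * k) (hy : |y| < D) : deriv tri (θ - y) = -1 := by
  have hy' := abs_lt.mp hy
  have hlo : Real.pi / 2 + 2 * Real.pi * k < θ - y := by linarith
  have hhi : θ - y < 3 * Real.pi / 2 + 2 * Real.pi * k := by linarith
  have hev : tri =ᶠ[𝓝 (θ - y)] fun t => Real.pi - (t - 2 * Real.pi * k) := by
    filter_upwards [Ioo_mem_nhds hlo hhi] with t ht
    have hper : tri t = tri (t - k * (2 * Real.pi)) := (tri_periodic.sub_int_mul_eq k).symm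
    rw [hper, show t - k * (2 * Real.pi) = t - 2 * Real.pi * k by ring]
    exact tri_eq_pi_sub (by linarith [ht.1]) (by linarith [ht.2])
  have hd : HasDerivAt tri (-1) (θ - y) := by
    have h0 : HasDerivAt (fun t : ℝ => Real.pi - (t - 2 * Real.pi * k)) (-1) (θ - y) := by
      have := ((hasDerivAt_id (θ - y)).sub_const (2 * Real.pi * (k : ℝ))).const_sub Real.pi
      simpa using this
    exact h0.congr_of_eventuallyEq hev
  exact hd.deriv

/-- **Flat slope `+1`**: for `θ` with `[θ − D, θ + D]` inside an ascending branch `(−π/2, π/2) + 2πk`,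
`|S_δ′(θ) − 1| ≤ 4δ e^{−D²/2δ²}/(D√(2π))`. [cite: Folland1999, §8.2 Prop. 8.10 and Prop. 2.53] -/
theorem abs_deriv_roundedSaw_sub_one_le {δ D θ : ℝ} (hδ : 0 < δ) (hD : 0 < D) (k : ℤ)
    (h₁ : -(Real.pi / 2) + 2 * Real.pi * k < θ - D) (h₂ : θ + D < Real.pi / 2 + 2 * Real.pi * k) :
    |deriv (roundedSaw δ) θ - 1| ≤ 4 * δ * Real.exp (-(D ^ 2 / (2 * δ ^ 2))) / (D * Real.sqrt (2 * Real.pi)) :=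
  abs_deriv_roundedSaw_sub_le hδ hD (by norm_num) fun _ hy => deriv_tri_sub_eq_one k h₁ h₂ hy

/-- **Flat slope `−1`**: for `θ` with `[θ − D, θ + D]` inside a descending branch `(π/2, 3π/2) + 2πk`,
`|S_δ′(θ) + 1| ≤ 4δ e^{−D²/2δ²}/(D√(2π))`. [cite: Folland1999, §8.2 Prop. 8.10 and Prop. 2.53] -/
theorem abs_deriv_roundedSaw_add_one_le {δ D θ : ℝ} (hδ : 0 < δ) (hD : 0 < D) (k : ℤ)
    (h₁ : Real.pi / 2 + 2 * Real.pi * k < θ - D) (h₂ : θ + D < 3 * Real.pi / 2 + 2 * Real.pi * k) :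
    |deriv (roundedSaw δ) θ + 1| ≤ 4 * δ * Real.exp (-(D ^ 2 / (2 * δ ^ 2))) / (D * Real.sqrt (2 * Real.pi)) := by
  have := abs_deriv_roundedSaw_sub_le (s := -1) hδ hD (by norm_num) fun _ hy => deriv_tri_sub_eq_neg_one k h₁ h₂ hy
  simpa [sub_neg_eq_add] using this

/-! ## §4 In standard deviations, and for the cascade profile `U j` -/

/-- `4/(M√(2π)) ≤ 2` for `M ≥ 1` (`√(2π) ≥ 2`). [folklore] -/
theorem four_div_le_two {M : ℝ} (hM : 1 ≤ M) : 4 / (M * Real.sqrt (2 * Real.pi)) ≤ 2 := by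
  have hπ : 2 ≤ Real.sqrt (2 * Real.pi) :=
    (Real.le_sqrt (by norm_num) (by positivity)).mpr (by nlinarith [Real.pi_gt_three])
  have hpos : 0 < M * Real.sqrt (2 * Real.pi) := by positivity
  rw [div_le_iff₀ hpos]
  nlinarith

/-- **Flat slope in standard deviations**: at `θ`-distance `≥ Mδ` (`M ≥ 1`) inside one branch, `|S_δ′(θ) − s| ≤ 2e^{−M²/2}`.
[cite: Folland1999, §8.2 Prop. 8.10 and Prop. 2.53] -/
theorem abs_deriv_roundedSaw_sub_le_of_sd {δ M θ s : ℝ} (hδ : 0 < δ) (hM : 1 ≤ M) (hs1 : |s| ≤ 1)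
    (hs : ∀ y : ℝ, |y| < M * δ → deriv tri (θ - y) = s) :
    |deriv (roundedSaw δ) θ - s| ≤ 2 * Real.exp (-(M ^ 2 / 2)) := by
  have hD : 0 < M * δ := by positivity
  have h := abs_deriv_roundedSaw_sub_le hδ hD hs1 hs
  have hexp : -((M * δ) ^ 2 / (2 * δ ^ 2)) = -(M ^ 2 / 2) := by
    field_simp
  rw [hexp] at h
  refine h.trans ?_
  have hδne : δ ≠ 0 := hδ.ne'
  rw [show 4 * δ * Real.exp (-(M ^ 2 / 2)) / (M * δ * Real.sqrt (2 * Real.pi)) =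
      4 / (M * Real.sqrt (2 * Real.pi)) * Real.exp (-(M ^ 2 / 2)) by field_simp]
  exact mul_le_mul_of_nonneg_right (four_div_le_two hM) (Real.exp_pos _).le

/-- **Flat slope of the cascade profile, ascending strips**: `U_j′(y) = S_{δ_j}′(2πN_j y)` (tree `deriv_U_eq`), so for `y`
whose phase `2πN_j y` is `Mδ_j`-inside an ascending branch (`M ≥ 1`), `|U_j′(y) − 1| ≤ 2e^{−M²/2}` (`δ j > 0`, `N j ≠ 0`).
[cite: ElgindiLissMattingly2025, §1 (H_α, V_α: slope ±1 branches; here mollified)] -/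
theorem abs_deriv_U_sub_one_le (P : CascadeParams) {j : ℕ} (hδ : 0 < P.δ j) (hN : P.N j ≠ 0) {M y : ℝ}
    (hM : 1 ≤ M) (k : ℤ) (h₁ : -(Real.pi / 2) + 2 * Real.pi * k < 2 * Real.pi * P.N j * y - M * P.δ j)
    (h₂ : 2 * Real.pi * P.N j * y + M * P.δ j < Real.pi / 2 + 2 * Real.pi * k) :
    |deriv (P.U j) y - 1| ≤ 2 * Real.exp (-(M ^ 2 / 2)) := by
  rw [P.deriv_U_eq hδ hN]
  exact abs_deriv_roundedSaw_sub_le_of_sd hδ hM (by norm_num) fun _ hy => deriv_tri_sub_eq_one k h₁ h₂ hy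

/-- **Flat slope of the cascade profile, descending strips**: for `y` whose phase `2πN_j y` is `Mδ_j`-inside a descending
branch (`M ≥ 1`), `|U_j′(y) + 1| ≤ 2e^{−M²/2}`. [cite: ElgindiLissMattingly2025, §1 (H_α, V_α: slope ±1 branches; here mollified)] -/
theorem abs_deriv_U_add_one_le (P : CascadeParams) {j : ℕ} (hδ : 0 < P.δ j) (hN : P.N j ≠ 0) {M y : ℝ}
    (hM : 1 ≤ M) (k : ℤ) (h₁ : Real.pi / 2 + 2 * Real.pi * k < 2 * Real.pi * P.N j * y - M * P.δ j)
    (h₂ : 2 * Real.pi * P.N j * y + M * P.δ j < 3 * Real.pi / 2 + 2 * Real.pi * k) :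
    |deriv (P.U j) y + 1| ≤ 2 * Real.exp (-(M ^ 2 / 2)) := by
  rw [P.deriv_U_eq hδ hN]
  have := abs_deriv_roundedSaw_sub_le_of_sd (s := -1) hδ hM (by norm_num)
    fun _ hy => deriv_tri_sub_eq_neg_one k h₁ h₂ hy
  simpa [sub_neg_eq_add] using this

/-- The slope floor of TEST H: with `M = √(2(j+1))` (so `M ≥ 1`), `2e^{−M²/2} = 2e^{−(j+1)} ≤ 2^{−j}`: at `√(2(j+1))` standard
deviations from the corners the cascade profile has slope within `2^{−j}` of `±1`. [folklore] -/
theorem two_mul_exp_neg_le_half_pow (j : ℕ) : 2 * Real.exp (-((Real.sqrt (2 * ((j : ℝ) + 1))) ^ 2 / 2)) ≤ (1 / 2 : ℝ) ^ j := by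
  have hj : (0 : ℝ) ≤ 2 * ((j : ℝ) + 1) := by positivity
  rw [Real.sq_sqrt hj, show 2 * ((j : ℝ) + 1) / 2 = (j : ℝ) + 1 by ring]
  -- `2 e^{-(j+1)} = (2/e) e^{-j} ≤ e^{-j} ≤ 2^{-j}`
  have he : 2 ≤ Real.exp 1 := by
    have := Real.add_one_le_exp (1 : ℝ); linarith
  have h1 : 2 * Real.exp (-((j : ℝ) + 1)) ≤ Real.exp (-(j : ℝ)) := by
    rw [show -((j : ℝ) + 1) = -(j : ℝ) + (-1) by ring, Real.exp_add, Real.exp_neg (1 : ℝ)]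
    have hpos : 0 < Real.exp (-(j : ℝ)) := Real.exp_pos _
    have hinv : 2 * (Real.exp 1)⁻¹ ≤ 1 := by
      rw [mul_inv_le_iff₀ (Real.exp_pos 1)]; linarith
    nlinarith
  have h2 : Real.exp (-(j : ℝ)) ≤ (1 / 2 : ℝ) ^ j := by
    rw [show -(j : ℝ) = (j : ℕ) * (-1 : ℝ) by ring, Real.exp_nat_mul]
    refine pow_le_pow_left₀ (Real.exp_pos _).le ?_ j
    rw [Real.exp_neg, inv_le_comm₀ (Real.exp_pos 1) (by norm_num : (0:ℝ) < 1 / 2)]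
    norm_num
    exact he
  exact h1.trans h2

end Summit.AnomalousDissipation.AnomalousDissipation.Theorems.SawtoothPulseCascade.K1Flat
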